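import Literature.AnabelianGeometry.EtaleTheta.KummerNaturalityPartialAut
import Literature.IUT.HodgeTheaters.GlobalFrobenioidsCoricRigidityOfDivisors
import HarnessLib

/-!
# [IUTchI] Example 5.1 (v), pp. 127–128: law (a) "Kummer naturality" AT THE PAIR `π₁^rat ↷ 𝕄^⊛_∞κ`,
# DISCHARGED at the genuine Kummer map (proof-only)

S. Mochizuki, *Inter-universal Teichmüller theory I*, kurims manuscript (May 2020), §5, Example 5.1 (v),
p. 127 l. 13–35 and l. 57 – p. 128 l. 24 ([IUTchI] Ex 5.1 (v) pp.127–128) [claim: Mochizuki2012, status: disputed]: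
an ∞κ-coric structure on `†ℱ^⊛` is a pair "consisting of a pseudo-monoid equipped with a continuous action by
`π₁^rat(†𝒟^⊛)`" isomorphic to the MODEL pair `π₁^rat(†𝒟^⊛) ↷ 𝕄^⊛_∞κ(†𝒟^⊚)`; "by considering the Kummer
classes ⊆ `lim_{→ H} H¹(H, μ_Ẑ(†𝕄^⊛_∞κ))` … the asserted injectivity follows … there exists a unique
isomorphism of cyclotomes … `†ℱ^⊛` always admits an ∞κ-coric structure, which is, moreover, unique up to a
uniquely determined isomorphism".  Remark 3.1.7 (ii) p. 67: "an element `f ∈ L̄_C` is ∞κ-coric if there exists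
a positive integer `n` such that `fⁿ` is a `κ`-coric element of `L_C`" — so `𝕄^⊛_∞κ` is ROOT- and POWER-CLOSED
in `L̄_C^×` and contains `1` and all roots of unity (`1` is `κ`-coric; [IUTchI] §0 p. 33: a *divisible*,
*cyclotomic* pseudo-monoid).  LANA §6.1 pp. 31–32 [LANA2026Report]: the Kummer map.

Sub-DAG `plan/L5/SUBDAG-IUTchI-Ex51.md` rows E51/L25–L27 (a) ⇒ E51/L29; GAP-LEDGER G-w4d056-2; node
IUTchI:Ex5.1(v).  PROOF-ONLY: theorems, no definition, no new `Prop` fact.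

**State before this file.**  `CoricPair.kummerRigid_of_divisors` / `NFBridgeRecon.existsUniqueCoricStructure_
infκPair_of_divisors` (abc-iut-w4-d056 gen 3, `GlobalFrobenioidsCoricRigidityOfDivisors.lean`) derive the boxed
uniqueness from four hypotheses at a Kummer realisation `κ` of the model pair: (a) `hnat` — every AUTOMORPHISM OF
THE PAIR acts on Kummer classes through some `u ∈ Ẑ^× = Aut(Ẑ)`; (b′) `hord`; Rmk 3.1.7 (i) `hpole`/`hex`.  Law (a)
was a THEOREM only for automorphisms of the whole module `K^×` (`CoMorphism.kummerMap_equivariant_eq_twist`,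
`KummerContainerZHatTwist.lean`); an automorphism of the pair (abc-iut-L5-t1's `CoricPair.Iso`) is merely a
`π₁^rat`-equivariant bijection of the SUBSET `𝕄^⊛_∞κ ⊆ K_rat^×` respecting partial products.

**What this file proves** — for `N : NFBridgeRecon.{0}` [abc-iut-L5-t1's Ex 5.1 (i) interface; universe `0`
because Mathlib's group cohomology, hence the L2 Kummer lane, is single-universe], ANY units action of `π₁^rat` on
`K_rat^×` compatible with the field action (`hcoe`; e.g. Mathlib's `Units.mulDistribMulActionRight`), ANY directed
exhaustive system `S` of subgroups of `π₁^rat` (the levels `H` of "`lim_{→ H}`"), `K_rat^×` rootable and containing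
a primitive `n`-th root of unity for every `n` [true for `L̄_C`], and the STRUCTURAL hypotheses `1 ∈ 𝕄^⊛_∞κ`,
`f ∈ 𝕄^⊛_∞κ ⇔ fⁿ ∈ 𝕄^⊛_∞κ` [Rmk 3.1.7 (ii), by definition of ∞κ-coric]:
* `NFBridgeRecon.infκPair_exists_zhatTwist_kummerMap_iso` — **LAW (a) AT THE PAIR**: every
  `e : CoricPair.Iso N.infκPair N.infκPair` acts on the GENUINE Kummer classes `κ(f) := kummerMap (f ∈ K_rat^×)`
  through a unique `u_e ∈ Ẑ^×`: `κ(e f) = u_e • κ(f)` for all `f ∈ 𝕄^⊛_∞κ` (engine: abc-iut-w4-d056's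
  `exists_zhatTwist_kummerMap_of_partialMul`, `KummerNaturalityPartialAut.lean` — the Kummer cocycle of `e f`
  with the transported roots is `e ∘` the cocycle of `f`, and `e|_{μ_∞}` is a cyclotomic character);
* `NFBridgeRecon.infκPair_kummer_natural_of_factor` — hence `hnat` holds for every Kummer realisation `κ` of
  the model ∞κ-pair that FACTORS through the genuine Kummer map by a `Ẑ^×`-equivariant map of containers;
* `NFBridgeRecon.existsUniqueCoricStructure_infκPair_of_divisors_of_factor` — **Ex. 5.1 (v) "unique up to a
  uniquely determined isomorphism" for the ∞κ-pair with law (a) DISCHARGED**: the remaining hypotheses are (b′)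
  `hord` ([AbsTopIII] Prop. 1.6 (iii), GAP G-w4d056-2 (b′)), Rmk 3.1.7 (i) `hpole`/`hex` (THEOREMS at
  abc-iut-L5-t2's typing, same file as before), the factorisation of `κ`, and the structural hypotheses above.
NOT covered: the "respectively, ∞κ×-coric" clause — `𝕄^⊛_∞κ× = U_L · 𝕄^⊛_∞κ` (Rmk 3.1.7 (ii)) is NOT
root-closed, and its intrinsic Kummer map needs an ambient choice; nothing is claimed for it here.  No side is
taken on [IUTchIII] Cor. 3.12; nothing of the disputed series is asserted; typed ≠ proved.
-/

namespace Literature.IUT.HodgeTheaters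

open ProfiniteGrp ProfiniteGrp.ProfiniteCompletion
open Literature.AnabelianGeometry.EtaleTheta Literature.AnabelianGeometry.EtaleTheta.ZHatLevel

namespace NFBridgeRecon

variable (N : NFBridgeRecon.{0})

/-! ### The model ∞κ-pair inside `K_rat^×` -/

/-- Elements of `𝕄^⊛_∞κ(†𝒟^⊚)` are nonzero rational functions (`0 ∉ 𝕄^⊛_∞κ× ⊇ 𝕄^⊛_∞κ`, Ex. 5.1 (i)).
([IUTchI] Ex 5.1 (i) p.124) [claim: Mochizuki2012, status: disputed] -/
theorem coe_infκPair_ne_zero (x : N.infκPair.carrier) : (x : N.Krat) ≠ 0 := fun h =>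
  N.zero_notMem (N.minfκ_subset (h ▸ x.2))

/-- A nonzero check for an element of `𝕄^⊛_∞κ` given by membership. ([IUTchI] Ex 5.1 (i) p.124)
[claim: Mochizuki2012, status: disputed] -/
theorem ne_zero_of_mem_minfκ {f : N.Krat} (hf : f ∈ N.Minfκ) : f ≠ 0 := fun h =>
  N.zero_notMem (N.minfκ_subset (h ▸ hf))

variable [MulDistribMulAction N.piRat N.Kratˣ]

/-- `𝕄^⊛_∞κ`, viewed in `K_rat^×`, is `π₁^rat`-stable (for any units action compatible with the field action).
([IUTchI] Ex 5.1 (i) p.124) [claim: Mochizuki2012, status: disputed] -/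
theorem units_preimage_minfκ_smul_mem
    (hcoe : ∀ (g : N.piRat) (a : N.Kratˣ), ((g • a : N.Kratˣ) : N.Krat) = g • (a : N.Krat))
    (g : N.piRat) (a : N.Kratˣ) (ha : a ∈ (Units.val ⁻¹' N.Minfκ : Set N.Kratˣ)) :
    g • a ∈ (Units.val ⁻¹' N.Minfκ : Set N.Kratˣ) := by
  rw [Set.mem_preimage, hcoe]
  exact N.smul_mem_minfκ g ha

omit [MulDistribMulAction N.piRat N.Kratˣ] in
/-- Root- and power-closure of `𝕄^⊛_∞κ` (Rmk 3.1.7 (ii): `f` is ∞κ-coric iff `fⁿ` is `κ`-coric for some `n ≥ 1`)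
transferred to `K_rat^×`. ([IUTchI] Rmk 3.1.7 (ii) p.67) [claim: Mochizuki2012, status: disputed] -/
theorem units_preimage_minfκ_pow_iff (hpow : ∀ (f : N.Krat) (n : ℕ), 0 < n → (f ∈ N.Minfκ ↔ f ^ n ∈ N.Minfκ))
    (a : N.Kratˣ) (n : ℕ) (hn : 0 < n) :
    a ∈ (Units.val ⁻¹' N.Minfκ : Set N.Kratˣ) ↔ a ^ n ∈ (Units.val ⁻¹' N.Minfκ : Set N.Kratˣ) := by
  rw [Set.mem_preimage, Set.mem_preimage, Units.val_pow_eq_pow_val]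
  exact hpow _ n hn

/-! ### An automorphism of the pair as a partial automorphism of `K_rat^×`

An automorphism `e` of the pair `π₁^rat ↷ 𝕄^⊛_∞κ` (a `CoricPair.Iso`) is only defined on `𝕄^⊛_∞κ`; any map
`eU : K_rat^× → K_rat^×` agreeing with `e` on `𝕄^⊛_∞κ` (hypothesis `he` below; one exists, `exists_units_extension`)
is multiplicative on `𝕄^⊛_∞κ`-products (`e` respects the partial multiplication), `π₁^rat`-equivariant on `𝕄^⊛_∞κ`,
and inverted on `𝕄^⊛_∞κ` by any extension of `e⁻¹`. -/

section Extension

variable (e : CoricPair.Iso N.infκPair N.infκPair)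

omit [MulDistribMulAction N.piRat N.Kratˣ] in
/-- Some map `K_rat^× → K_rat^×` extends the automorphism `e` of the pair (extend by the identity off `𝕄^⊛_∞κ`).
([IUTchI] Ex 5.1 (v) p.127) [claim: Mochizuki2012, status: disputed] -/
theorem exists_units_extension : ∃ eU : N.Kratˣ → N.Kratˣ, ∀ (a : N.Kratˣ) (h : (a : N.Krat) ∈ N.Minfκ),
    (eU a : N.Krat) = ((e.toEquiv ⟨(a : N.Krat), h⟩ : N.infκPair.carrier) : N.Krat) := by
  classical
  refine ⟨fun a => if h : (a : N.Krat) ∈ N.Minfκ then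
      Units.mk0 ((e.toEquiv ⟨(a : N.Krat), h⟩ : N.infκPair.carrier) : N.Krat) (N.coe_infκPair_ne_zero _)
    else a, fun a h => ?_⟩
  simp only [dif_pos h, Units.val_mk0]

variable {eU : N.Kratˣ → N.Kratˣ}
  (he : ∀ (a : N.Kratˣ) (h : (a : N.Krat) ∈ N.Minfκ),
    (eU a : N.Krat) = ((e.toEquiv ⟨(a : N.Krat), h⟩ : N.infκPair.carrier) : N.Krat))

include he

omit [MulDistribMulAction N.piRat N.Kratˣ] in
/-- An extension of `e` maps `𝕄^⊛_∞κ` into `𝕄^⊛_∞κ`. ([IUTchI] Ex 5.1 (v) p.127) [claim: Mochizuki2012, status: disputed] -/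
theorem units_extension_mem (a : N.Kratˣ) (ha : a ∈ (Units.val ⁻¹' N.Minfκ : Set N.Kratˣ)) :
    eU a ∈ (Units.val ⁻¹' N.Minfκ : Set N.Kratˣ) := by
  rw [Set.mem_preimage, he a ha]
  exact (e.toEquiv ⟨(a : N.Krat), ha⟩).2

omit [MulDistribMulAction N.piRat N.Kratˣ] in
/-- An extension of `e` is MULTIPLICATIVE on products staying in `𝕄^⊛_∞κ`: `e` respects the partial
multiplication of the pseudo-monoid, which is the field multiplication restricted to such pairs
(`CoricPair.Iso.op` for abc-iut-w5-d110's `coricPairOfSubset`). ([IUTchI] Ex 5.1 (v) p.127)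
[claim: Mochizuki2012, status: disputed] -/
theorem units_extension_mul (a : N.Kratˣ) (ha : a ∈ (Units.val ⁻¹' N.Minfκ : Set N.Kratˣ)) (b : N.Kratˣ)
    (hb : b ∈ (Units.val ⁻¹' N.Minfκ : Set N.Kratˣ)) (hab : a * b ∈ (Units.val ⁻¹' N.Minfκ : Set N.Kratˣ)) :
    eU (a * b) = eU a * eU b := by
  have hab' : ((a : N.Krat) * b) ∈ N.Minfκ := by rwa [Set.mem_preimage, Units.val_mul] at hab
  apply Units.ext
  rw [Units.val_mul, he a ha, he b hb, he (a * b) hab]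
  have hop := e.op ⟨((⟨(a : N.Krat), ha⟩ : N.infκPair.carrier), (⟨(b : N.Krat), hb⟩ : N.infκPair.carrier)), hab'⟩
  exact congrArg (fun y : N.infκPair.carrier => (y : N.Krat)) hop

/-- An extension of `e` is `π₁^rat`-EQUIVARIANT on `𝕄^⊛_∞κ` (`CoricPair.Iso.smul`). ([IUTchI] Ex 5.1 (v) p.127)
[claim: Mochizuki2012, status: disputed] -/
theorem units_extension_smul
    (hcoe : ∀ (g : N.piRat) (a : N.Kratˣ), ((g • a : N.Kratˣ) : N.Krat) = g • (a : N.Krat))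
    (g : N.piRat) (a : N.Kratˣ) (ha : a ∈ (Units.val ⁻¹' N.Minfκ : Set N.Kratˣ)) :
    eU (g • a) = g • eU a := by
  have hga : g • a ∈ (Units.val ⁻¹' N.Minfκ : Set N.Kratˣ) := N.units_preimage_minfκ_smul_mem hcoe g a ha
  apply Units.ext
  rw [hcoe, he a ha, he (g • a) hga]
  have hx : (⟨((g • a : N.Kratˣ) : N.Krat), hga⟩ : N.infκPair.carrier) =
      g • (⟨(a : N.Krat), ha⟩ : N.infκPair.carrier) := Subtype.ext (hcoe g a)
  rw [hx, e.smul]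
  rfl

omit [MulDistribMulAction N.piRat N.Kratˣ] in
/-- An extension of `e⁻¹` (`CoricPair.Iso.symm`, abc-iut-w5-d110) inverts an extension of `e` on `𝕄^⊛_∞κ`.
([IUTchI] Ex 5.1 (v) p.127) [claim: Mochizuki2012, status: disputed] -/
theorem units_extension_symm_apply {eV : N.Kratˣ → N.Kratˣ}
    (he' : ∀ (a : N.Kratˣ) (h : (a : N.Krat) ∈ N.Minfκ),
      (eV a : N.Krat) = ((e.symm.toEquiv ⟨(a : N.Krat), h⟩ : N.infκPair.carrier) : N.Krat))
    (a : N.Kratˣ) (ha : a ∈ (Units.val ⁻¹' N.Minfκ : Set N.Kratˣ)) : eV (eU a) = a := by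
  have hea : eU a ∈ (Units.val ⁻¹' N.Minfκ : Set N.Kratˣ) := N.units_extension_mem e he a ha
  apply Units.ext
  rw [he' (eU a) hea]
  have hx : (⟨((eU a : N.Kratˣ) : N.Krat), hea⟩ : N.infκPair.carrier) =
      e.toEquiv (⟨(a : N.Krat), ha⟩ : N.infκPair.carrier) := Subtype.ext (he a ha)
  rw [hx]
  exact congrArg (fun y : N.infκPair.carrier => (y : N.Krat)) (e.toEquiv.symm_apply_apply _)

end Extension

/-! ### Law (a) at the pair -/

variable {ι : Type} [Preorder ι] [DecidableEq ι] [IsDirectedOrder ι] (S : ι → Subgroup N.piRat)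
  (hS : ∀ ⦃i j : ι⦄, i ≤ j → S j ≤ S i) [RootableBy N.Kratˣ ℕ]

/-- **[IUTchI] Ex. 5.1 (v) LAW (a) "KUMMER NATURALITY" AT THE PAIR `π₁^rat ↷ 𝕄^⊛_∞κ`, DISCHARGED at the
genuine Kummer map.**  Let `N` be the Ex. 5.1 (i) data with `K_rat^×` rootable, a primitive `n`-th root of
unity in `K_rat` for every `n ≥ 1`, `1 ∈ 𝕄^⊛_∞κ` and `f ∈ 𝕄^⊛_∞κ ⇔ fⁿ ∈ 𝕄^⊛_∞κ` (Rmk 3.1.7 (ii)); let `S` be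
any directed system of subgroups of `π₁^rat` exhausting `K_rat^×` by invariants (the levels of `lim_{→ H}`).
Then EVERY automorphism `e` of the pair acts on the genuine Kummer classes `κ(f) = kummerMap f ∈
lim_{→} H¹(S i, Λ(K_rat^×))` through an element `u ∈ Ẑ^× = Aut(Ẑ)`: `κ(e f) = u · κ(f)` for all `f ∈ 𝕄^⊛_∞κ`,
where `u` is the cyclotomic character of `e` on the roots of unity `μ_∞ ⊆ 𝕄^⊛_∞κ`.  PROVED (engine:
`exists_zhatTwist_kummerMap_of_partialMul`).  This is hypothesis `hnat` of `CoricPair.kummerRigid_of_divisors`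
at the genuine Kummer map. ([IUTchI] Ex 5.1 (v) p.127) [claim: Mochizuki2012, status: disputed] -/
theorem infκPair_exists_zhatTwist_kummerMap_iso
    (hcoe : ∀ (g : N.piRat) (a : N.Kratˣ), ((g • a : N.Kratˣ) : N.Krat) = g • (a : N.Krat))
    (hprim : ∀ n : ℕ, 0 < n → ∃ ζ : N.Krat, IsPrimitiveRoot ζ n) (hc : IsExhausted N.Kratˣ S)
    (h1 : (1 : N.Krat) ∈ N.Minfκ) (hpow : ∀ (f : N.Krat) (n : ℕ), 0 < n → (f ∈ N.Minfκ ↔ f ^ n ∈ N.Minfκ))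
    (e : CoricPair.Iso N.infκPair N.infκPair) :
    ∃ u : MulAut (completion (GrpCat.of (Multiplicative ℤ))),
      (∀ (ζ : cyclotome N.Kratˣ) (n : ℕ+),
        ((e.toEquiv ⟨(((ζ : ℕ+ → N.Kratˣ) n : N.Kratˣ) : N.Krat),
            mem_of_pow_eq_one_of_closed (M := (Units.val ⁻¹' N.Minfκ : Set N.Kratˣ)) h1
              (N.units_preimage_minfκ_pow_iff hpow) n.pos (cyclotome.pow_eq_one ζ n)⟩ :
            N.infκPair.carrier) : N.Krat) =
          (((cyclotome.zhatTwist N.Kratˣ u ζ : cyclotome N.Kratˣ) : ℕ+ → N.Kratˣ) n : N.Krat)) ∧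
      ∀ x : N.infκPair.carrier,
        kummerMap hS hc (Units.mk0 ((e.toEquiv x : N.infκPair.carrier) : N.Krat) (N.coe_infκPair_ne_zero _)) =
          H1ColimTwist S hS u (kummerMap hS hc (Units.mk0 (x : N.Krat) (N.coe_infκPair_ne_zero x))) := by
  obtain ⟨eU, he⟩ := N.exists_units_extension e
  obtain ⟨eV, he'⟩ := N.exists_units_extension e.symm
  have h1' : (1 : N.Kratˣ) ∈ (Units.val ⁻¹' N.Minfκ : Set N.Kratˣ) := by
    rw [Set.mem_preimage, Units.val_one]; exact h1
  obtain ⟨u, hu, hκ⟩ := exists_zhatTwist_kummerMap_of_partialMul S hS hprim hc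
    (N.units_preimage_minfκ_smul_mem hcoe) h1' (N.units_preimage_minfκ_pow_iff hpow)
    (N.units_extension_mul e he) (N.units_extension_mul e.symm he')
    (N.units_extension_symm_apply e he he')
    (fun a ha => by
      have h := N.units_extension_symm_apply e.symm he' (eV := eU) (fun b hb => by
        rw [he b hb]; rfl) a ha
      exact h)
    (N.units_extension_smul e he hcoe)
  refine ⟨u, fun ζ n => ?_, fun x => ?_⟩
  · have hmem : (((ζ : ℕ+ → N.Kratˣ) n : N.Kratˣ) : N.Krat) ∈ N.Minfκ :=
      mem_of_pow_eq_one_of_closed (M := (Units.val ⁻¹' N.Minfκ : Set N.Kratˣ)) h1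
        (N.units_preimage_minfκ_pow_iff hpow) n.pos (cyclotome.pow_eq_one ζ n)
    rw [← he _ hmem, hu ζ n]
  · have hx : Units.mk0 (x : N.Krat) (N.coe_infκPair_ne_zero x) ∈ (Units.val ⁻¹' N.Minfκ : Set N.Kratˣ) := by
      rw [Set.mem_preimage, Units.val_mk0]; exact x.2
    have hex : eU (Units.mk0 (x : N.Krat) (N.coe_infκPair_ne_zero x)) =
        Units.mk0 ((e.toEquiv x : N.infκPair.carrier) : N.Krat) (N.coe_infκPair_ne_zero _) := by
      apply Units.ext
      have hxe : (⟨((Units.mk0 (x : N.Krat) (N.coe_infκPair_ne_zero x) : N.Kratˣ) : N.Krat), hx⟩ :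
          N.infκPair.carrier) = x := Subtype.ext (Units.val_mk0 (N.coe_infκPair_ne_zero x))
      rw [he _ hx, hxe, Units.val_mk0]
    rw [← hex]
    exact hκ _ hx

/-- **Law (a) in `hnat` form for Kummer realisations factoring through the genuine Kummer map.**  If a Kummer
realisation `κ` of the model ∞κ-pair (abc-iut-L5-t12's `CoricPair.KummerRealization`, in a container `H` with
`Ẑ^×`-action) factors as `κ = Φ ∘ kummerMap` with `Φ` `Ẑ^×`-equivariant [e.g. `Φ = id` on
`lim_{→} H¹(S i, Λ K_rat^×)` with `zhatMulAction`, or a change of coefficients], then every automorphism of the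
pair acts on `κ`-classes through some `u ∈ Ẑ^×` — hypothesis `hnat` of `CoricPair.kummerRigid_of_divisors`.
([IUTchI] Ex 5.1 (v) p.127) [claim: Mochizuki2012, status: disputed] -/
theorem infκPair_kummer_natural_of_factor
    (hcoe : ∀ (g : N.piRat) (a : N.Kratˣ), ((g • a : N.Kratˣ) : N.Krat) = g • (a : N.Krat))
    (hprim : ∀ n : ℕ, 0 < n → ∃ ζ : N.Krat, IsPrimitiveRoot ζ n) (hc : IsExhausted N.Kratˣ S)
    (h1 : (1 : N.Krat) ∈ N.Minfκ) (hpow : ∀ (f : N.Krat) (n : ℕ), 0 < n → (f ∈ N.Minfκ ↔ f ^ n ∈ N.Minfκ))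
    {H : Type} [CommGroup H] [MulAction N.piRat H]
    [MulAction (MulAut (completion (GrpCat.of (Multiplicative ℤ)))) H] (κ : N.infκPair.KummerRealization H)
    (Φ : H1Colimit N.Kratˣ S hS → H)
    (hΦ : ∀ (u : MulAut (completion (GrpCat.of (Multiplicative ℤ)))) (z : H1Colimit N.Kratˣ S hS),
      Φ (H1ColimTwist S hS u z) = u • Φ z)
    (hκΦ : ∀ x : N.infκPair.carrier,
      κ.toFun x = Φ (kummerMap hS hc (Units.mk0 (x : N.Krat) (N.coe_infκPair_ne_zero x)))) :
    ∀ e : CoricPair.Iso N.infκPair N.infκPair, ∃ u : MulAut (completion (GrpCat.of (Multiplicative ℤ))),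
      ∀ x : N.infκPair.carrier, κ.toFun (e.toEquiv x) = u • κ.toFun x := by
  intro e
  obtain ⟨u, -, hκ⟩ := N.infκPair_exists_zhatTwist_kummerMap_iso S hS hcoe hprim hc h1 hpow e
  exact ⟨u, fun x => by rw [hκΦ, hκΦ, hκ x, hΦ]⟩

/-- **Ex. 5.1 (v) for the model ∞κ-pair with LAW (a) DISCHARGED**: "`†ℱ^⊛` always admits an ∞κ-coric structure,
which is, moreover, unique up to a uniquely determined isomorphism" — `ExistsUniqueCoricStructure π₁^rat 𝕄^⊛_∞κ`
— follows, for a Kummer realisation `κ` factoring `Ẑ^×`-equivariantly through the genuine Kummer map, from the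
REMAINING printed inputs only: (b′) `hord` — `Ẑ^×` acts by multiplication on the integer divisors of `κ`-coric
functions ([AbsTopIII] Prop. 1.6 (iii); GAP G-w4d056-2 (b′)); Rmk 3.1.7 (i) `hpole` (a `κ`-coric function has at
most one pole) and `hex` (some `κ`-coric function has two distinct zeroes) — both THEOREMS at abc-iut-L5-t2's
typing (`CriticalLocus.IsKappaCoric.not_two_poles`, `CriticalLocus.exists_isKappaCoric_two_zeroes`); and the
structural hypotheses `1 ∈ 𝕄^⊛_∞κ`, `f ∈ 𝕄^⊛_∞κ ⇔ fⁿ ∈ 𝕄^⊛_∞κ`, rootability and roots of unity of `K_rat`.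
PROVED (composition with `existsUniqueCoricStructure_infκPair_of_divisors`). ([IUTchI] Ex 5.1 (v) p.128)
[claim: Mochizuki2012, status: disputed] -/
theorem existsUniqueCoricStructure_infκPair_of_divisors_of_factor (hκinv : N.MκIsInvariants)
    (hcoe : ∀ (g : N.piRat) (a : N.Kratˣ), ((g • a : N.Kratˣ) : N.Krat) = g • (a : N.Krat))
    (hprim : ∀ n : ℕ, 0 < n → ∃ ζ : N.Krat, IsPrimitiveRoot ζ n) (hc : IsExhausted N.Kratˣ S)
    (h1 : (1 : N.Krat) ∈ N.Minfκ) (hpow : ∀ (f : N.Krat) (n : ℕ), 0 < n → (f ∈ N.Minfκ ↔ f ^ n ∈ N.Minfκ))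
    {H : Type} [CommGroup H] [MulAction N.piRat H]
    [MulAction (MulAut (completion (GrpCat.of (Multiplicative ℤ)))) H] (κ : N.infκPair.KummerRealization H)
    (Φ : H1Colimit N.Kratˣ S hS → H)
    (hΦ : ∀ (u : MulAut (completion (GrpCat.of (Multiplicative ℤ)))) (z : H1Colimit N.Kratˣ S hS),
      Φ (H1ColimTwist S hS u z) = u • Φ z)
    (hκΦ : ∀ x : N.infκPair.carrier,
      κ.toFun x = Φ (kummerMap hS hc (Units.mk0 (x : N.Krat) (N.coe_infκPair_ne_zero x))))
    {X : Type*} (ord : X → N.Krat → ℤ)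
    (hord : ∀ (u : MulAut (completion (GrpCat.of (Multiplicative ℤ)))) (f f' : N.infκPair.carrier),
      (f : N.Krat) ∈ N.Mκ → (f' : N.Krat) ∈ N.Mκ → κ.toFun f' = u • κ.toFun f →
      ∀ x : X, u (eta (ord x f)) = eta (ord x f'))
    (hpole : ∀ f' ∈ N.Mκ, ∀ x₁ x₂ : X, x₁ ≠ x₂ → ¬ (ord x₁ f' < 0 ∧ ord x₂ f' < 0))
    (hex : ∃ f ∈ N.Mκ, ∃ x₁ x₂ : X, x₁ ≠ x₂ ∧ 0 < ord x₁ f ∧ 0 < ord x₂ f) :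
    ExistsUniqueCoricStructure N.piRat N.infκPair :=
  N.existsUniqueCoricStructure_infκPair_of_divisors hκinv κ
    (N.infκPair_kummer_natural_of_factor S hS hcoe hprim hc h1 hpow κ Φ hΦ hκΦ) ord hord hpole hex

end NFBridgeRecon

end Literature.IUT.HodgeTheaters
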